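/-
Copyright: the b2b-balaban T⁴-continuum CRUX team, row NE7b OWNER lineage `t4-ne7b-p1` (gen 107). Project licence.
-/
import Literature.Probability.Moments.BrascampLiebVarianceViaPrekopaLeindler

/-!
# THE BRASCAMP–LIEB VARIANCE INEQUALITY ON A CONVEX WINDOW: `Var_{ν_{V,K}}(f) ≤ λ⁻¹ ∫‖Df‖² dν_{V,K}` for the WINDOWED tilt
# `ν_{V,K} = 1_K e^{−V}dx ∕ ∫_K e^{−V}`, `K` CONVEX, `V` `λ`-uniformly convex ON `K` ONLY (row NE7b, node U5c; the refuter's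
# σ-ne7bref-g68-2 «penalty lemma», proved WITHOUT the penalty; kernel theorems)

Cell `pub-balaban`, sub-cell `t4`, spine estimate NE7b (`T4WeightBudget.RelWeightBound`; the cell's OWN estimate — NOT PRINTED in
[Bałaban 1983–89], NOT PROVED).  Crux-route work under `Spine/NE7b/` by the row's OWNER; NOTHING of Bałaban's is named or asserted;
no `T4Continuum/Support` leaf typed; no `def`; zero `sorry`.

WHY.  The owner's convexity road (`…NE7b.ConvexTiltMoment`, T-60a′) bounds the sacrificed exponential moment by tilted second
moments through the tree's Brascamp–Lieb variance inequality `Literature.Probability.Moments.variance_tilted_le`, whose letter asks the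
exponent `V` to be `λ`-uniformly convex on the WHOLE carrier.  Print's exponents are convex only on their small-field WINDOWS, which
ARE convex sets (balls ∕ slabs; idea-1 T-61, refuter F397), and `ConvexTiltMoment` §4 carried a window only at the price of a
whole-carrier convex extension plus a mass-fraction divisor `1∕(1−η)`.  The refuter (PRICING-NE7b v72 F395 (Q1)(b), σ-ne7bref-g68-2;
idea-1 g61 T-61b (ii)) booked ONE kernel lemma of real analysis: Brascamp–Lieb for the windowed tilt with convexity used ON `K` ONLY,
suggested via the penalty `V + N·dist(·,K)²` and monotone convergence.  THIS FILE proves that lemma DIRECTLY, without a penalty: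
Prékopa–Leindler (the tree's `Literature.Analysis.Convexity.prekopaLeindler_integral`) is applied to the INDICATOR-weighted triple
`1_K e^{−V}`, `1_K e^{−V+εφ}`, `1_K e^{−V+εφ∕2+ε²w}` — the only convexity input is the midpoint inequality of `V` between points of
`K`, whose midpoint lies in `K` —, the tree's Hopf–Lax bound `hopfLax_le` and second-order extraction `variance_le_of_exp_moment_le`
are used BY NAME, and general `C¹` test functions are reached by EXHAUSTION `K ∩ B̄(0,R)`, `R → ∞` (on a bounded window every `C¹`
function agrees with a compactly supported one), not by bump truncation.

WHAT IS PROVED ([folklore] real analysis; [cite: BrascampLieb1976, Thm 4.1] for the inequality itself):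
* §1 `midpoint_mem_and_le_of_uniformlyConvexOn` — `V(½x+½y) + (λ∕8)‖x−y‖² ≤ (V x + V y)∕2` for `x, y ∈ K`, from the first-order
  letter ON `K`.
* §2 `setIntegral_exp_mul_setIntegral_exp_le_sq` (Prékopa–Leindler at `s = ½` for exponentials RESTRICTED to a convex `K`) and
  **`integral_exp_windowTilted_le_sq`**: `∫ e^{εφ} dν_{V,K} ≤ (∫ e^{εφ∕2 + ε²(‖Dφ‖+δ)²∕(8λ)} dν_{V,K})²` for `φ ∈ C¹_c`, small `ε`.
* §3 **`variance_windowTilted_le_of_hasCompactSupport`**: `Var_{ν_{V,K}}(φ) ≤ λ⁻¹∫‖Dφ‖² dν_{V,K}` for `φ ∈ C¹_c`.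
* §4 **`variance_windowTilted_le`**: the same for `C¹` `f` with `f, f², ‖Df‖² ∈ L¹(ν_{V,K})`, by exhaustion.
Letters: `K` convex and measurable with `volume K ≠ 0`; `V` continuous on the carrier (its values OFF `K` never enter — any continuous
extension serves) with `∀ x ∈ K, ∀ y ∈ K, V x + ⟪∇V x, y − x⟫ + (λ∕2)‖y − x‖² ≤ V y`; `e^{−V}` integrable ON `K`.

NOT HERE (honest): the road's display on the window (`…NE7b.ConvexWindowTiltMoment`, next file); which `K`, `V`, `λ` Bałaban's steps
produce (Δ4-num ∕ (A3) readings); anything of Bałaban's.  NE7b NOT PRINTED ∕ NOT PROVED; spine PROVED 0∕9; rung (B)+1 on a FINITE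
torus — NOT infinite volume, NOT the mass gap, NOT Clay.
HONEST DEPENDENCY: continuum YM on T⁴ ⇐ BetaPertH ∧ nine spine estimates (0/9 proved); BetaPertH ⇐ (D1) ∧ (D4) ∧ CAP+tail.
-/

set_option autoImplicit false

noncomputable section

open MeasureTheory Real Set Filter Topology Metric
open scoped RealInnerProductSpace
open Literature.Probability.Moments

namespace Summit.QuantumFields.BalabanUV.T4Continuum.NE7b.ConvexWindowBrascampLieb

variable {n : ℕ}

/-! ## §1 Midpoint convexity from the first-order letter ON `K` -/

/-- For `K` convex and `V` `λ`-uniformly convex ON `K` in the first-order sense, the midpoint of two points of `K` lies in `K` and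
`V(½x + ½y) + (λ∕8)‖x − y‖² ≤ (V x + V y)∕2`. [folklore] -/
theorem midpoint_mem_and_le_of_uniformlyConvexOn {V : EuclideanSpace ℝ (Fin n) → ℝ} {lam : ℝ}
    {K : Set (EuclideanSpace ℝ (Fin n))} (hK : Convex ℝ K)
    (hV : ∀ x ∈ K, ∀ y ∈ K, V x + ⟪gradient V x, y - x⟫ + lam / 2 * ‖y - x‖ ^ 2 ≤ V y)
    {x y : EuclideanSpace ℝ (Fin n)} (hx : x ∈ K) (hy : y ∈ K) :
    (1 / 2 : ℝ) • x + (1 / 2 : ℝ) • y ∈ K ∧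
      V ((1 / 2 : ℝ) • x + (1 / 2 : ℝ) • y) + lam / 8 * ‖x - y‖ ^ 2 ≤ (V x + V y) / 2 := by
  have hz : (1 / 2 : ℝ) • x + (1 / 2 : ℝ) • y ∈ K := hK hx hy (by norm_num) (by norm_num) (by norm_num)
  refine ⟨hz, ?_⟩
  set z := (1 / 2 : ℝ) • x + (1 / 2 : ℝ) • y with hzdef
  have h1 := hV z hz x hx
  have h2 := hV z hz y hy
  have hxz : x - z = (1 / 2 : ℝ) • (x - y) := by rw [hzdef]; module
  have hyz : y - z = -((1 / 2 : ℝ) • (x - y)) := by rw [hzdef]; module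
  have hinner : ⟪gradient V z, x - z⟫ + ⟪gradient V z, y - z⟫ = 0 := by
    rw [← inner_add_right, hxz, hyz, add_neg_cancel, inner_zero_right]
  have hhalf : ‖(1 / 2 : ℝ) • (x - y)‖ = 1 / 2 * ‖x - y‖ := by
    rw [norm_smul, Real.norm_eq_abs, abs_of_pos (by norm_num : (0:ℝ) < 1 / 2)]
  have hn1 : ‖x - z‖ ^ 2 = 1 / 4 * ‖x - y‖ ^ 2 := by rw [hxz, hhalf]; ring
  have hn2 : ‖y - z‖ ^ 2 = 1 / 4 * ‖x - y‖ ^ 2 := by rw [hyz, norm_neg, hhalf]; ring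
  rw [hn1] at h1
  rw [hn2] at h2
  linarith

/-! ## §2 Prékopa–Leindler on a convex window and the windowed exponential-moment inequality -/

/-- **Prékopa–Leindler at `s = ½` for exponentials RESTRICTED to a convex window**: if `(p x + q y)∕2 ≤ r(½x + ½y)` for `x, y ∈ K`,
`K` convex measurable, then `(∫_K eᵖ)(∫_K e^q) ≤ (∫_K eʳ)²` — the tree's `prekopaLeindler_integral` applied to the indicator-weighted
functions `1_K eᵖ, 1_K e^q, 1_K eʳ` (off `K × K` the hypothesis is `0 ≤ ·`). [cite: BrascampLieb1976, Thm 3.3] -/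
theorem setIntegral_exp_mul_setIntegral_exp_le_sq {p q r : EuclideanSpace ℝ (Fin n) → ℝ}
    {K : Set (EuclideanSpace ℝ (Fin n))} (hK : Convex ℝ K) (hKm : MeasurableSet K)
    (hp : Continuous p) (hq : Continuous q) (hr : Continuous r)
    (hpi : IntegrableOn (fun x => exp (p x)) K) (hqi : IntegrableOn (fun x => exp (q x)) K)
    (hri : IntegrableOn (fun x => exp (r x)) K)
    (H : ∀ x ∈ K, ∀ y ∈ K, (p x + q y) / 2 ≤ r ((1 / 2 : ℝ) • x + (1 / 2 : ℝ) • y)) :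
    (∫ x in K, exp (p x)) * (∫ y in K, exp (q y)) ≤ (∫ z in K, exp (r z)) ^ 2 := by
  have h0 : ∀ (g : EuclideanSpace ℝ (Fin n) → ℝ) (x : EuclideanSpace ℝ (Fin n)), 0 ≤ K.indicator (fun x => exp (g x)) x :=
    fun g x => Set.indicator_nonneg (fun _ _ => (exp_pos _).le) x
  have key := Literature.Analysis.Convexity.prekopaLeindler_integral (n := n) (s := 1 / 2)
    (by norm_num) (by norm_num) (hp.rexp.measurable.indicator hKm) (hq.rexp.measurable.indicator hKm)
    (hr.rexp.measurable.indicator hKm) (h0 p) (h0 q) (h0 r)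
    (hpi.integrable_indicator hKm) (hqi.integrable_indicator hKm) (hri.integrable_indicator hKm)
    (fun x y => by
      by_cases hx : x ∈ K
      · by_cases hy : y ∈ K
        · have hm : (1 - 1 / 2 : ℝ) • x + (1 / 2 : ℝ) • y ∈ K := hK hx hy (by norm_num) (by norm_num) (by norm_num)
          rw [indicator_of_mem hx, indicator_of_mem hy, indicator_of_mem hm, ← exp_mul, ← exp_mul, ← exp_add]
          apply exp_le_exp.2
          have := H x hx y hy
          norm_num at this ⊢
          linarith
        · rw [indicator_of_notMem hy, Real.zero_rpow (by norm_num), mul_zero]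
          exact h0 r _
      · rw [indicator_of_notMem hx, Real.zero_rpow (by norm_num), zero_mul]
        exact h0 r _)
  rw [integral_indicator hKm, integral_indicator hKm, integral_indicator hKm] at key
  have h0p : 0 ≤ ∫ x in K, exp (p x) := integral_nonneg fun _ => (exp_pos _).le
  norm_num at key
  have hsq : ((∫ x in K, exp (p x)) ^ (1 / 2 : ℝ) * (∫ x in K, exp (q x)) ^ (1 / 2 : ℝ)) ^ 2 =
      (∫ x in K, exp (p x)) * (∫ y in K, exp (q y)) := by
    rw [mul_pow, ← rpow_natCast, ← rpow_natCast, ← rpow_mul h0p, ← rpow_mul (integral_nonneg fun _ => (exp_pos _).le)]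
    norm_num
  rw [← hsq]
  exact pow_le_pow_left₀ (by positivity) key 2

/-- **The windowed exponential-moment inequality** (Prékopa–Leindler linearised à la Bobkov–Ledoux, on a convex window): for `K` convex
measurable of positive volume, `V` continuous and `λ`-uniformly convex ON `K` (first-order letter between points of `K`), `e^{−V}`
integrable on `K`, `φ ∈ C¹_c`, `δ > 0`: for all small `ε > 0`, with `ν_{V,K} = 1_K e^{−V}dx ∕ ∫_K e^{−V}` and
`w = (‖Dφ‖ + δ)²∕(8λ)`, `∫ e^{εφ} dν_{V,K} ≤ (∫ e^{εφ∕2 + ε²w} dν_{V,K})²`. [cite: BrascampLieb1976, Thm 4.1] -/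
theorem integral_exp_windowTilted_le_sq {V φ : EuclideanSpace ℝ (Fin n) → ℝ} {lam : ℝ}
    {K : Set (EuclideanSpace ℝ (Fin n))} (hlam : 0 < lam) (hK : Convex ℝ K) (hKm : MeasurableSet K)
    (hK0 : volume K ≠ 0) (hVc : Continuous V)
    (hV : ∀ x ∈ K, ∀ y ∈ K, V x + ⟪gradient V x, y - x⟫ + lam / 2 * ‖y - x‖ ^ 2 ≤ V y)
    (hZ : IntegrableOn (fun x => exp (-V x)) K) (hφ : ContDiff ℝ 1 φ) (hφs : HasCompactSupport φ)
    {δ : ℝ} (hδ : 0 < δ) :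
    ∃ ε₀ > 0, ∀ ε, 0 < ε → ε ≤ ε₀ →
      ∫ x, exp (ε * φ x) ∂((volume.restrict K).tilted fun x => -V x) ≤
        (∫ x, exp (ε / 2 * φ x + ε ^ 2 * ((‖fderiv ℝ φ x‖ + δ) ^ 2 / (8 * lam)))
          ∂((volume.restrict K).tilted fun x => -V x)) ^ 2 := by
  haveI : NeZero (volume.restrict K : Measure (EuclideanSpace ℝ (Fin n))) :=
    ⟨fun h => hK0 (Measure.restrict_eq_zero.1 h)⟩
  obtain ⟨a₀, ha₀, hHL⟩ := hopfLax_le hφ hφs hδ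
  obtain ⟨M, hM⟩ := hφ.continuous.bounded_above_of_compact_support hφs
  have hDc : Continuous (fderiv ℝ φ) := hφ.continuous_fderiv one_ne_zero
  obtain ⟨L, hL⟩ := hDc.bounded_above_of_compact_support (hφs.fderiv (𝕜 := ℝ))
  set w : EuclideanSpace ℝ (Fin n) → ℝ := fun x => (‖fderiv ℝ φ x‖ + δ) ^ 2 / (8 * lam) with hw
  have hwc : Continuous w := ((hDc.norm.add continuous_const).pow 2).div_const _
  have hwb : ∀ x, w x ≤ (L + δ) ^ 2 / (8 * lam) := fun x => by
    have hLx := hL x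
    rw [hw]
    exact div_le_div_of_nonneg_right (pow_le_pow_left₀ (by positivity) (by linarith) 2) (by positivity)
  have hZpos : 0 < ∫ x in K, exp (-V x) := integral_exp_pos hZ
  refine ⟨2 * lam * a₀, by positivity, fun ε hε hεle => ?_⟩
  set a := ε / (2 * lam) with ha
  have ha0 : 0 < a := by positivity
  have haa : a ≤ a₀ := by rw [ha, div_le_iff₀ (by positivity)]; linarith
  -- the Prékopa–Leindler hypothesis, between points of `K`
  have hyp : ∀ x ∈ K, ∀ y ∈ K,
      (-V x + (-V y + ε * φ y)) / 2 ≤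
        -V ((1 / 2 : ℝ) • x + (1 / 2 : ℝ) • y) +
          (ε / 2 * φ ((1 / 2 : ℝ) • x + (1 / 2 : ℝ) • y) + ε ^ 2 * w ((1 / 2 : ℝ) • x + (1 / 2 : ℝ) • y)) := by
    intro x hx y hy
    set m := (1 / 2 : ℝ) • x + (1 / 2 : ℝ) • y with hm
    have h1 := (midpoint_mem_and_le_of_uniformlyConvexOn hK hV hx hy).2
    have h2 := hHL a ha0 haa y m
    have hym : ‖y - m‖ ^ 2 = 1 / 4 * ‖x - y‖ ^ 2 := by
      have : y - m = (1 / 2 : ℝ) • (y - x) := by rw [hm]; module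
      rw [this, norm_smul, Real.norm_eq_abs, abs_of_pos (by norm_num : (0:ℝ) < 1 / 2), norm_sub_rev]
      ring
    have e1 : ε / 2 * (a / 2 * (‖fderiv ℝ φ m‖ + δ) ^ 2) = ε ^ 2 * w m := by
      rw [hw, ha]; field_simp; ring
    have e2 : ε / 2 * (‖y - m‖ ^ 2 / (2 * a)) = lam / 8 * ‖x - y‖ ^ 2 := by
      rw [hym, ha]; field_simp; ring
    have key : ε / 2 * φ y - lam / 8 * ‖x - y‖ ^ 2 ≤ ε / 2 * φ m + ε ^ 2 * w m := by
      have := mul_le_mul_of_nonneg_left h2 (by positivity : (0:ℝ) ≤ ε / 2)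
      rw [mul_sub, mul_add, e2, e1] at this
      exact this
    rw [← hm] at h1
    linarith
  -- integrability of the three exponentials on `K`
  have hφm' : AEStronglyMeasurable (fun x => exp (ε * φ x)) (volume.restrict K) :=
    (continuous_exp.comp (continuous_const.mul hφ.continuous)).aestronglyMeasurable
  have hqi : IntegrableOn (fun x => exp (-V x + ε * φ x)) K := by
    have e : (fun x => exp (-V x + ε * φ x)) = fun x => exp (ε * φ x) * exp (-V x) := by
      ext x; rw [exp_add, mul_comm]
    rw [IntegrableOn, e]
    refine hZ.bdd_mul (c := exp (ε * M)) hφm' (Eventually.of_forall fun x => ?_)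
    rw [Real.norm_eq_abs, abs_of_pos (exp_pos _), exp_le_exp]
    have := hM x
    rw [Real.norm_eq_abs] at this
    nlinarith [le_abs_self (φ x)]
  have hrm' : AEStronglyMeasurable (fun x => exp (ε / 2 * φ x + ε ^ 2 * w x)) (volume.restrict K) :=
    (continuous_exp.comp ((continuous_const.mul hφ.continuous).add (continuous_const.mul hwc))).aestronglyMeasurable
  have hri : IntegrableOn (fun x => exp (-V x + (ε / 2 * φ x + ε ^ 2 * w x))) K := by
    have e : (fun x => exp (-V x + (ε / 2 * φ x + ε ^ 2 * w x))) =
        fun x => exp (ε / 2 * φ x + ε ^ 2 * w x) * exp (-V x) := by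
      ext x; rw [exp_add, mul_comm]
    rw [IntegrableOn, e]
    refine hZ.bdd_mul (c := exp (ε / 2 * M + ε ^ 2 * ((L + δ) ^ 2 / (8 * lam)))) hrm'
      (Eventually.of_forall fun x => ?_)
    rw [Real.norm_eq_abs, abs_of_pos (exp_pos _), exp_le_exp]
    have h1 := hM x
    rw [Real.norm_eq_abs] at h1
    have h2 := hwb x
    nlinarith [le_abs_self (φ x)]
  have PL := setIntegral_exp_mul_setIntegral_exp_le_sq (p := fun x => -V x) (q := fun x => -V x + ε * φ x)
    (r := fun x => -V x + (ε / 2 * φ x + ε ^ 2 * w x)) hK hKm hVc.neg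
    (hVc.neg.add (continuous_const.mul hφ.continuous))
    (hVc.neg.add ((continuous_const.mul hφ.continuous).add (continuous_const.mul hwc))) hZ hqi hri hyp
  -- pass to the windowed tilt
  rw [integral_exp_tilted, integral_exp_tilted]
  simp only [Pi.add_apply]
  rw [div_pow, div_le_div_iff₀ hZpos (pow_pos hZpos 2)]
  nlinarith [PL, hZpos.le]


/-! ## §3 The variance inequality for compactly supported test functions -/

/-- Bounded continuous functions are integrable for a finite measure. [folklore] -/
private theorem integrable_of_abs_le {X : Type*} [MeasurableSpace X] {ν : Measure X} [IsFiniteMeasure ν] {u : X → ℝ}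
    (hu : AEStronglyMeasurable u ν) (C : ℝ) (h : ∀ x, |u x| ≤ C) : Integrable u ν :=
  (integrable_const C).mono' hu (Eventually.of_forall fun x => by simpa [Real.norm_eq_abs] using h x)

/-- **Brascamp–Lieb on a convex window, `C¹_c` test functions**: for `K` convex measurable of positive volume, `V` continuous and
`λ`-uniformly convex ON `K`, `e^{−V}` integrable on `K`, and `φ ∈ C¹_c`:
`Var_{ν_{V,K}}(φ) ≤ λ⁻¹ ∫‖Dφ‖² dν_{V,K}`, `ν_{V,K} = 1_K e^{−V}dx ∕ ∫_K e^{−V}`.  From `integral_exp_windowTilted_le_sq` and the tree's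
`variance_le_of_exp_moment_le`, letting `δ → 0`. [cite: BrascampLieb1976, Thm 4.1] -/
theorem variance_windowTilted_le_of_hasCompactSupport {V φ : EuclideanSpace ℝ (Fin n) → ℝ} {lam : ℝ}
    {K : Set (EuclideanSpace ℝ (Fin n))} (hlam : 0 < lam) (hK : Convex ℝ K) (hKm : MeasurableSet K)
    (hK0 : volume K ≠ 0) (hVc : Continuous V)
    (hV : ∀ x ∈ K, ∀ y ∈ K, V x + ⟪gradient V x, y - x⟫ + lam / 2 * ‖y - x‖ ^ 2 ≤ V y)
    (hZ : IntegrableOn (fun x => exp (-V x)) K) (hφ : ContDiff ℝ 1 φ) (hφs : HasCompactSupport φ) :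
    ∫ x, φ x ^ 2 ∂((volume.restrict K).tilted fun x => -V x) -
        (∫ x, φ x ∂((volume.restrict K).tilted fun x => -V x)) ^ 2 ≤
      lam⁻¹ * ∫ x, ‖fderiv ℝ φ x‖ ^ 2 ∂((volume.restrict K).tilted fun x => -V x) := by
  haveI : NeZero (volume.restrict K : Measure (EuclideanSpace ℝ (Fin n))) :=
    ⟨fun h => hK0 (Measure.restrict_eq_zero.1 h)⟩
  set ν : Measure (EuclideanSpace ℝ (Fin n)) := (volume.restrict K).tilted fun x => -V x with hν
  haveI : IsProbabilityMeasure ν := isProbabilityMeasure_tilted hZ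
  obtain ⟨M, hM⟩ := hφ.continuous.bounded_above_of_compact_support hφs
  have hM0 : 0 ≤ M := (norm_nonneg _).trans (hM 0)
  have hDc : Continuous (fderiv ℝ φ) := hφ.continuous_fderiv one_ne_zero
  obtain ⟨L, hL⟩ := hDc.bounded_above_of_compact_support (hφs.fderiv (𝕜 := ℝ))
  have hL0 : 0 ≤ L := (norm_nonneg _).trans (hL 0)
  have hφb : ∀ x, |φ x| ≤ M := fun x => by simpa [Real.norm_eq_abs] using hM x
  have hφm : AEStronglyMeasurable φ ν := hφ.continuous.aestronglyMeasurable
  have hDn : Continuous fun x => ‖fderiv ℝ φ x‖ := hDc.norm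
  have hID : Integrable (fun x => ‖fderiv ℝ φ x‖ ^ 2) ν :=
    integrable_of_abs_le (hDn.pow 2).aestronglyMeasurable (L ^ 2) fun x => by
      rw [abs_of_nonneg (sq_nonneg _)]
      exact pow_le_pow_left₀ (norm_nonneg _) (hL x) 2
  refine le_of_forall_pos_le_add fun η hη => ?_
  -- choose δ with λ⁻¹ (2Lδ + δ²) ≤ η
  set δ : ℝ := min 1 (η * lam / (2 * L + 1)) with hδ_def
  have hδ : 0 < δ := by positivity
  have hδ1 : δ ≤ 1 := min_le_left _ _
  have hδη : lam⁻¹ * (2 * L * δ + δ ^ 2) ≤ η := by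
    have h1 : δ ≤ η * lam / (2 * L + 1) := min_le_right _ _
    rw [le_div_iff₀ (by positivity)] at h1
    have h2 : δ ^ 2 ≤ δ := by nlinarith
    rw [inv_mul_le_iff₀ hlam]
    nlinarith
  obtain ⟨ε₀, hε₀, Hε⟩ := integral_exp_windowTilted_le_sq hlam hK hKm hK0 hVc hV hZ hφ hφs hδ
  set w : EuclideanSpace ℝ (Fin n) → ℝ := fun x => (‖fderiv ℝ φ x‖ + δ) ^ 2 / (8 * lam) with hw
  have hwc : Continuous w := ((hDn.add continuous_const).pow 2).div_const _
  have hwb : ∀ x, w x ≤ (L + δ) ^ 2 / (8 * lam) := fun x => by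
    have hLx := hL x
    rw [hw]
    exact div_le_div_of_nonneg_right (pow_le_pow_left₀ (by positivity) (by linarith) 2) (by positivity)
  have hw0 : ∀ x, 0 ≤ w x := fun x => by rw [hw]; positivity
  have hvar := variance_le_of_exp_moment_le ν hφm hwc.aestronglyMeasurable hM0
    (by positivity : (0:ℝ) ≤ (L + δ) ^ 2 / (8 * lam)) hε₀ hφb hw0 hwb Hε
  -- `8 ∫ w = λ⁻¹ ∫ (‖Dφ‖ + δ)²`
  have hIsq : Integrable (fun x => (‖fderiv ℝ φ x‖ + δ) ^ 2) ν :=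
    integrable_of_abs_le ((hDn.add continuous_const).pow 2).aestronglyMeasurable ((L + δ) ^ 2) fun x => by
      rw [abs_of_nonneg (sq_nonneg _)]
      exact pow_le_pow_left₀ (by positivity) (by linarith [hL x]) 2
  have e8 : 8 * ∫ x, w x ∂ν = lam⁻¹ * ∫ x, (‖fderiv ℝ φ x‖ + δ) ^ 2 ∂ν := by
    rw [← integral_const_mul, ← integral_const_mul]
    congr 1; ext x; rw [hw]; field_simp
  -- `∫ (‖Dφ‖ + δ)² ≤ ∫ ‖Dφ‖² + (2Lδ + δ²)`
  have hle : ∫ x, (‖fderiv ℝ φ x‖ + δ) ^ 2 ∂ν ≤ ∫ x, ‖fderiv ℝ φ x‖ ^ 2 ∂ν + (2 * L * δ + δ ^ 2) := by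
    have e : ∫ x, ‖fderiv ℝ φ x‖ ^ 2 ∂ν + (2 * L * δ + δ ^ 2) =
        ∫ x, (‖fderiv ℝ φ x‖ ^ 2 + (2 * L * δ + δ ^ 2)) ∂ν := by
      rw [integral_add hID (integrable_const _)]; simp
    rw [e]
    refine integral_mono hIsq (hID.add (integrable_const _)) fun x => ?_
    have := hL x
    nlinarith [norm_nonneg (fderiv ℝ φ x)]
  calc ∫ x, φ x ^ 2 ∂ν - (∫ x, φ x ∂ν) ^ 2 ≤ 8 * ∫ x, w x ∂ν := hvar
    _ = lam⁻¹ * ∫ x, (‖fderiv ℝ φ x‖ + δ) ^ 2 ∂ν := e8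
    _ ≤ lam⁻¹ * (∫ x, ‖fderiv ℝ φ x‖ ^ 2 ∂ν + (2 * L * δ + δ ^ 2)) :=
        mul_le_mul_of_nonneg_left hle (by positivity)
    _ = lam⁻¹ * ∫ x, ‖fderiv ℝ φ x‖ ^ 2 ∂ν + lam⁻¹ * (2 * L * δ + δ ^ 2) := by ring
    _ ≤ lam⁻¹ * ∫ x, ‖fderiv ℝ φ x‖ ^ 2 ∂ν + η := by linarith

/-! ## §4 General `C¹` test functions, by exhaustion of the window -/

/-- **BRASCAMP–LIEB ON A CONVEX WINDOW** (the Poincaré inequality for the windowed `λ`-uniformly log-concave tilt).  For `K` convex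
measurable of positive volume, `V` continuous on the carrier and `λ`-uniformly convex ON `K` in the first-order sense
(`∀ x ∈ K, ∀ y ∈ K, V x + ⟪∇V x, y − x⟫ + (λ∕2)‖y − x‖² ≤ V y` — nothing is asked of `V` off `K`), `e^{−V}` integrable on `K`, and a
`C¹` test function `f` with `f, f², ‖Df‖² ∈ L¹(ν_{V,K})`, `ν_{V,K} = 1_K e^{−V}dx ∕ ∫_K e^{−V}`:
`∫ f² dν_{V,K} − (∫ f dν_{V,K})² ≤ λ⁻¹ ∫ ‖Df‖² dν_{V,K}`.
From the compactly supported case on the bounded convex windows `K ∩ B̄(0,R)` (where `f` agrees, together with its derivative, with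
the compactly supported `χ_R·f`, `χ_R` a bump equal to `1` on `B̄(0,R+1)`), and `R → ∞` by monotone convergence of the four weighted
integrals. [cite: BrascampLieb1976, Thm 4.1] -/
theorem variance_windowTilted_le {V f : EuclideanSpace ℝ (Fin n) → ℝ} {lam : ℝ}
    {K : Set (EuclideanSpace ℝ (Fin n))} (hlam : 0 < lam) (hK : Convex ℝ K) (hKm : MeasurableSet K)
    (hK0 : volume K ≠ 0) (hVc : Continuous V)
    (hV : ∀ x ∈ K, ∀ y ∈ K, V x + ⟪gradient V x, y - x⟫ + lam / 2 * ‖y - x‖ ^ 2 ≤ V y)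
    (hZ : IntegrableOn (fun x => exp (-V x)) K) (hf : ContDiff ℝ 1 f)
    (h1 : Integrable f ((volume.restrict K).tilted fun x => -V x))
    (h2 : Integrable (fun x => f x ^ 2) ((volume.restrict K).tilted fun x => -V x))
    (h3 : Integrable (fun x => ‖fderiv ℝ f x‖ ^ 2) ((volume.restrict K).tilted fun x => -V x)) :
    ∫ x, f x ^ 2 ∂((volume.restrict K).tilted fun x => -V x) -
        (∫ x, f x ∂((volume.restrict K).tilted fun x => -V x)) ^ 2 ≤
      lam⁻¹ * ∫ x, ‖fderiv ℝ f x‖ ^ 2 ∂((volume.restrict K).tilted fun x => -V x) := by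
  haveI : NeZero (volume.restrict K : Measure (EuclideanSpace ℝ (Fin n))) :=
    ⟨fun h => hK0 (Measure.restrict_eq_zero.1 h)⟩
  -- transfer of tilted integrals and integrability to weighted set integrals
  have T : ∀ (S : Set (EuclideanSpace ℝ (Fin n))) (g : EuclideanSpace ℝ (Fin n) → ℝ),
      ∫ x, g x ∂((volume.restrict S).tilted fun x => -V x) = (∫ x in S, g x * exp (-V x)) / ∫ x in S, exp (-V x) :=
    fun S g => by
      rw [integral_tilted, ← integral_div]
      congr 1; ext x; rw [smul_eq_mul]; ring
  have I : ∀ g : EuclideanSpace ℝ (Fin n) → ℝ, Integrable g ((volume.restrict K).tilted fun x => -V x) →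
      IntegrableOn (fun x => g x * exp (-V x)) K := fun g hg => by
    have := (integrable_tilted_iff hZ g).1 hg
    refine this.congr (Eventually.of_forall fun x => ?_)
    simp only [smul_eq_mul]; ring
  have hZpos : 0 < ∫ x in K, exp (-V x) := integral_exp_pos hZ
  -- the exhaustion `S R = K ∩ B̄(0,R)`
  set S : ℕ → Set (EuclideanSpace ℝ (Fin n)) := fun R => K ∩ closedBall 0 R with hS
  have hSK : ∀ R, S R ⊆ K := fun R => inter_subset_left
  have hSm : ∀ R, MeasurableSet (S R) := fun R => hKm.inter measurableSet_closedBall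
  have hSmono : Monotone S := fun R R' h =>
    inter_subset_inter_right _ (closedBall_subset_closedBall (by exact_mod_cast h))
  have hSU : (⋃ R, S R) = K := by
    refine Subset.antisymm (iUnion_subset fun R => hSK R) fun x hx => ?_
    obtain ⟨R, hR⟩ := exists_nat_ge ‖x‖
    exact mem_iUnion.2 ⟨R, hx, mem_closedBall_zero_iff.2 hR⟩
  have hSconv : ∀ R, Convex ℝ (S R) := fun R => hK.inter (convex_closedBall 0 _)
  -- monotone convergence of weighted set integrals along the exhaustion
  have lim : ∀ g : EuclideanSpace ℝ (Fin n) → ℝ, IntegrableOn g K →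
      Tendsto (fun R => ∫ x in S R, g x) atTop (𝓝 (∫ x in K, g x)) := fun g hg => by
    have hg' : IntegrableOn g (⋃ R, S R) := by rw [hSU]; exact hg
    have := tendsto_setIntegral_of_monotone (μ := volume) hSm hSmono hg'
    rwa [hSU] at this
  -- eventually the exhausting windows have positive volume
  have hev : ∀ᶠ R : ℕ in atTop, volume (S R) ≠ 0 := by
    have ht : Tendsto (volume ∘ S) atTop (𝓝 (volume K)) := by
      have := tendsto_measure_iUnion_atTop (μ := volume) hSmono
      rwa [hSU] at this
    exact ((tendsto_order.1 ht).1 0 (pos_iff_ne_zero.2 hK0)).mono fun R h => h.ne'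
  -- the inequality on each exhausting window of positive volume
  have hstep : ∀ R : ℕ, volume (S R) ≠ 0 →
      (∫ x in S R, f x ^ 2 * exp (-V x)) / (∫ x in S R, exp (-V x)) -
          ((∫ x in S R, f x * exp (-V x)) / ∫ x in S R, exp (-V x)) ^ 2 ≤
        lam⁻¹ * ((∫ x in S R, ‖fderiv ℝ f x‖ ^ 2 * exp (-V x)) / ∫ x in S R, exp (-V x)) := by
    intro R hR
    let χ : ContDiffBump (0 : EuclideanSpace ℝ (Fin n)) := ⟨(R : ℝ) + 1, (R : ℝ) + 2, by positivity, by linarith⟩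
    have hrIn : χ.rIn = (R : ℝ) + 1 := rfl
    have hχ1 : ∀ x ∈ S R, χ x = 1 := fun x hx => by
      apply χ.one_of_mem_closedBall
      rw [hrIn, mem_closedBall, dist_zero_right]
      have := mem_closedBall_zero_iff.1 hx.2
      linarith
    have hχev : ∀ x ∈ S R, (fun y => χ y * f y) =ᶠ[𝓝 x] f := fun x hx => by
      have hb : x ∈ ball (0 : EuclideanSpace ℝ (Fin n)) χ.rIn := by
        rw [hrIn, mem_ball, dist_zero_right]
        have := mem_closedBall_zero_iff.1 hx.2
        linarith
      filter_upwards [χ.eventuallyEq_one_of_mem_ball hb] with y hy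
      rw [hy, Pi.one_apply, one_mul]
    have hφ : ContDiff ℝ 1 (fun y => χ y * f y) := χ.contDiff.mul hf
    have hφs : HasCompactSupport (fun y => χ y * f y) := χ.hasCompactSupport.mul_right
    have key := variance_windowTilted_le_of_hasCompactSupport hlam (hSconv R) (hSm R) hR hVc
      (fun x hx y hy => hV x (hSK R hx) y (hSK R hy)) (hZ.mono_set (hSK R)) hφ hφs
    rw [T, T, T] at key
    have e1 : ∫ x in S R, χ x * f x * exp (-V x) = ∫ x in S R, f x * exp (-V x) :=
      setIntegral_congr_fun (hSm R) fun x hx => by rw [hχ1 x hx, one_mul]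
    have e2 : ∫ x in S R, (χ x * f x) ^ 2 * exp (-V x) = ∫ x in S R, f x ^ 2 * exp (-V x) :=
      setIntegral_congr_fun (hSm R) fun x hx => by rw [hχ1 x hx, one_mul]
    have e3 : ∫ x in S R, ‖fderiv ℝ (fun y => χ y * f y) x‖ ^ 2 * exp (-V x) =
        ∫ x in S R, ‖fderiv ℝ f x‖ ^ 2 * exp (-V x) :=
      setIntegral_congr_fun (hSm R) fun x hx => by rw [(hχev x hx).fderiv_eq]
    rw [e1, e2, e3] at key
    exact key
  -- pass to the limit `R → ∞`
  have limZ := lim (fun x => exp (-V x)) hZ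
  have limA := lim (fun x => f x * exp (-V x)) (I _ h1)
  have limB := lim (fun x => f x ^ 2 * exp (-V x)) (I _ h2)
  have limD := lim (fun x => ‖fderiv ℝ f x‖ ^ 2 * exp (-V x)) (I _ h3)
  have hlhs := (limB.div limZ hZpos.ne').sub ((limA.div limZ hZpos.ne').pow 2)
  have hrhs := (limD.div limZ hZpos.ne').const_mul lam⁻¹
  have hle := le_of_tendsto_of_tendsto hlhs hrhs (hev.mono fun R hR => hstep R hR)
  rwa [T, T, T]

end Summit.QuantumFields.BalabanUV.T4Continuum.NE7b.ConvexWindowBrascampLieb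

end
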